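import Mathlib
import Literature.MathematicalPhysics.QuantumFieldTheory.Dimock2011to13.LocalizedActionExpansion
import Literature.MathematicalPhysics.QuantumFieldTheory.Dimock2011to13.FreeFlowSingleStep

/-!
# Dimock, *The renormalization group according to Balaban* II, §2.4 LEMMA 2.5 (otto2): the single step for the
# LOCALIZED action `J*_{Λ,Ω_{k+1}} = (a/2L²)‖Φ_{k+1} − QΦ_k‖²_{Ω_{k+1}} + S*_k(Λ, Φ_k, φ)` expanded about
# `(Ψ_{k,Ω⁺}, φ⁰_{k+1,Ω⁺})`: `J* = S^{*,0}_{k+1} + ½⟨Z, [Δ_{k,Ω} + (a/L²)QᵀQ]_{Ω_{k+1}}Z⟩ + R_{k,Ω,Λ} + 𝔟_Λ(∂φ_{k,Ω}, 𝒵_{k,Ω})`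
# — PROVED on the joined carrier of `LocalizedActionExpansion` and `FreeFlowSingleStep`, with `R_{k,Ω,Λ}` in closed form

**Citation header (reproduction of PUBLISHED work; template of the Balaban lattice Yang–Mills cell).**
J. Dimock, *The renormalization group according to Balaban. II. Large fields*, J. Math. Phys. **54** (2013) 092301
(= arXiv:1212.5562v2) [Dimock2013BalabanII], §2.4 "a variation": the functional `J*_{Λ,Ω_{k+1}}` (jstar) L1050–1057,
LEMMA 2.5 (`\label{otto2}`, the 5th `\begin{lem}` of the source = Lemma 2.5 of the printed numbering, TEMPLATE.md §9;
statement L1060–1081 with the displays for `S^{*,0}_{k+1}` L1069–1075 and `R_{k,Ω,Λ}` L1077–1080) and its proof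
L1088–1116; the use site §3.6 (otto3) L2921–2946 and the localized form of the same remainder §3.13 (b2) L5010–5019.
TeX line numbers refer to the arXiv source held by the cell (`inputs/files/dimock/src/1212.5562/1212.5562.tex`, 7217
lines).  Dimock's papers are published and refereed and are the cell's TEMPLATE, not manuscripts under audit; no
quantity of the Bałaban series is touched.

**What the paper prints (verbatim).**  L1050–1057: *"Continuing with our assumption on Λ, we now investigate how the
single step analysis of section 2.3 changes, particularly (expand). We introduce J*_{Λ,Ω_{k+1}}(Φ_{k+1}, Φ_k, φ) =
(a/2L²)‖Φ_{k+1} − QΦ_k‖²_{Ω_{k+1}} + S*_k(Λ, Φ_k, φ)  (jstar)  and expand in Φ_{k,Ω_{k+1}} and φ around the minima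
Ψ_{k,Ω_{k+1}}(Ω⁺) and φ⁰_{k+1,Ω⁺} = φ_{k,Ω}(φ_{Ω₁ᶜ}, Ψ_{k,Ω⁺}) for the original problem with Ω⁺."*  **Lemma 2.5**
(L1060–1081): *"For Z : Ω^{(k)}_{k+1} → ℝ and 𝒵_{k,Ω} = φ_{k,Ω}(0,Z):  J*_{Λ,Ω_{k+1}}(Φ_{k+1}, Ψ_{k,Ω⁺} + (0,Z), φ⁰_{k+1,Ω⁺} +
𝒵_{k,Ω}) = S^{*,0}_{k+1}(Λ, Φ_{k+1,Ω⁺}, φ⁰_{k+1,Ω⁺}) + ½⟨Z, [Δ_{k,Ω} + (a/L²)QᵀQ]_{Ω_{k+1}}Z⟩ + R_{k,Ω,Λ} + 𝔟_Λ(∂φ_{k,Ω}, 𝒵)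
where S^{*,0}_{k+1}(Λ, Φ_{k+1,Ω⁺}, φ) = (a_{k+1}/2L²)‖Φ_{k+1} − Q_{k+1}φ‖²_{Ω_{k+1}} + (a_k/2)‖Φ_k − Q_kφ‖²_{Λ−Ω_{k+1}} +
½‖∂φ‖²_{*,Λ} + ½μ̄_k‖φ‖²_Λ  and  R_{k,Ω,Λ} ≡ −½‖𝐚^{1/2}Q_{k,Ω}𝒵_{k,Ω}‖²_{Λᶜ} + ‖∂𝒵_{k,Ω}‖²_{*,Λ} + ½μ̄_k‖𝒵_{k,Ω}‖²_{Λᶜ}"*.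
Proof (L1088–1116): *"By the previous lemma, and using again (loopy), our expression is (a/2L²)‖Φ_{k+1} − QΨ‖² +
(a/2L²)‖QZ‖² − (a/L²)⟨QZ, (Φ_{k+1} − QΨ)⟩ + S*_k(Λ, Ψ, φ⁰) + S*_k(Λ, (0,Z), 𝒵_{k,Ω}) + a_k⟨Z, (Ψ − Q_kφ⁰)⟩_{Ω_{k+1}} +
𝔟_Λ(∂φ_{k,Ω}, 𝒵)  However the linear terms vanish since (a/L²)Qᵀ(Φ_{k+1} − QΨ) = (a_{k+1}/L²)Qᵀ(Φ_{k+1} − Q_{k+1}φ⁰) =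
a_k(Ψ − Q_kφ⁰) as one can check by inserting the definition of Ψ from (eddie2). Also as in (stung), (stung2)
(a/2L²)‖Φ_{k+1} − QΨ‖² + S*_k(Λ, Ψ, φ⁰) = S^{*,0}_{k+1}(Λ, Φ_{k+1,Ω⁺}, φ⁰)  Finally (a/2L²)‖QZ‖² + S*_k(Λ, (0,Z), 𝒵_{k,Ω}) =
(a/2L²)‖QZ‖² + S_k(Ω₁, (0,Z), 𝒵_{k,Ω}) + R_{k,Ω,Λ} = ½⟨Z, [Δ_{k,Ω} + (a/L²)QᵀQ]_{Ω_{k+1}}Z⟩ + R_{k,Ω,Λ}  The last step is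
from (worry). This completes the proof."* (here `Ψ` abbreviates the print's `Ψ_{k,Ω_{k+1}}(Ω⁺)`, `φ⁰` its
`φ⁰_{k+1,Ω⁺}`).  §3.13 (b2) L5012–5018: *"R^{(1)}_{π,Ω_{k+1}} = Σ_{□ on ∂Λ_k} 𝔟_{Λ_k}[∂φ⁰_{k+1,Ω′}, 1_□𝒲^{loc}] − ½Σ_{□⊂Λ_kᶜ}
(a_k‖Q_{k,Ω(Λ_k^*)}𝒲^{loc}‖²_□ + ‖∂𝒲^{loc}‖²_{*,□} + μ̄_k‖𝒲^{loc}‖²_□)"*.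

**What is reproduced here (kernel-checked, zero `sorry`).**  THE JOINED CARRIER: the fine sites `V` with their graph
`G` (the carrier of `StarFormIdentity` / `LocalizedActionExpansion`: `‖∂φ‖²_{*,Λ}` = `formStar`, `𝔟_Λ` = `bdry`, weights
`w = L^{−3k}`, `h = L^{−k}`) ARE the index type `κ = V` of `MultiRegionFreeFlow` / `FreeFlowSingleStep` (`D =
[−Δ + μ̄_k]_{Ω₁}` a positive-definite matrix on `V`); the multiscale unit variable is split `ι ⊕ τ` (`ι = Ω^{(k)}_{k+1}`
with weight `a_k`, `τ` = every other layer with weight `𝐚_τ`), `Q_{k,Ω} = rows(Q_k, Q_τ)` serves both as the matrix of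
`MultiRegionFreeFlow.rowsO` and as the kernel of `LocalizedActionExpansion.Sstar` (`Qapp (rowsO Q_k Q_τ) φ = (Q_kφ,
Q_τφ)`), the unit sites of `Λ` are `Λ′ ⊆ ι ⊕ τ`, and the next step is `Q : σ × ι` with `QQᵀ = I`, `aL = a/L²`.  THE
HYPOTHESES, as printed: (geometry) `Ω_{k+1} ⊂ Λ` — every `inl i ∈ Λ′` (`hΩ`); *"Λ is any union of M-cubes"* — (H2)
`BlockLocal Λ Λ′ (rowsO Q_k Q_τ)`; *"separation between Ω₁ᶜ and Λ"* — (α) the rows of `D` at the sites of `Λ` are the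
lattice rows `w(−Δ + μ̄_k)` and (γ) the boundary source `[Δ]_{Ω₁,Ω₁ᶜ}φ_{Ω₁ᶜ}` vanishes on `Λ`; `Λ ⊂ Ω_k` — (H𝐚) `𝐚_τ` acts
as the scalar `a_k` on the layer sites inside `Λ′` (the level-`k` layer `δΩ_k ∩ Λ`; in print `𝐚` is diagonal with
`a^{(k)}_k = a_k`); and `D > 0`, `𝐚_τ ≥ 0`, `a_k > 0`, `aL ≥ 0`.  PROVED:
* §1 the objects: `Jstar` (jstar), `Sstar0` = `S^{*,0}_{k+1}` (L1069–1075, with `a_{k+1}L^{−2} = FreeFlowSingleStep.aNext a_k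
  aL` and `Q_{k+1} = QQ_k`), `R` = `R_{k,Ω,Λ}` DEFINED BY THE PROOF'S DISPLAY L1110–1112 (`S*_k(Λ, (0,Z), 𝒵_{k,Ω}) −
  S_k(Ω₁, (0,Z), 𝒵_{k,Ω})`, `S_k` = `MultiRegionFreeFlow.action`, `𝒵_{k,Ω}` = `FreeFlowSingleStep.calZ`), `normOff` =
  `‖𝐚^{1/2}·‖²_{Λᶜ}`, `collar` (the part of `⟨f, Df⟩` not carried by the bonds and sites of `V`: the Dirichlet bonds from
  `Ω₁` to `Ω₁ᶜ`);
* §2 **(H1) for the pair `(Ψ_{k,Ω⁺}, φ⁰_{k+1,Ω⁺})`** (`varEqOn_phi0`): by (loopy) = `FreeFlowSingleStep.minimizer_Psi_phi0`,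
  `φ⁰` is the level-`k` minimizer at the data `(Ψ, Φ_τ)`, so `MultiRegionFreeFlow.variational_eq` read at the sites of `Λ`
  under (α), (γ), (H2), (H𝐚) gives `LocalizedActionExpansion.VarEqOn` — the hypothesis of Lemma 2.4 (*"By the previous
  lemma, and using again (loopy)"*);
* §3 **the linear terms vanish** (`ak_smul_Psi_sub` = (cherry0) rearranged `a_k(Ψ − Q_kφ) = aL·Qᵀ(Φ_{k+1} − QΨ)`, from
  `FreeFlowSingleStep.oneStepH_mulVec_Psi`; `linear_terms`);
* §4 **(stung)/(stung2) for `S*`** (`constant_terms`, from `FreeFlowSingleStep.stringy_Psi`);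
* §5 **the quadratic terms** (`quadratic_terms_R`, from (worry) = `FreeFlowSingleStep.quadratic_terms`) and **`R_{k,Ω,Λ}` IN
  CLOSED FORM** (`R_eq`): `R_{k,Ω,Λ} = −[½‖𝐚^{1/2}Q_{k,Ω}𝒵‖²_{Λᶜ} + ½‖∂𝒵‖²_{*,Λᶜ} + ½μ̄_k‖𝒵‖²_{Λᶜ}] − ½collar(𝒵)` — the
  localized action drops exactly the `Λᶜ`-contributions of `S_k(Ω₁, (0,Z), 𝒵)`, by the additivity of the star form
  over `Λ ∪ Λᶜ` (`StarFormIdentity.formStar_union`, *"A similar decomposition holds for S*_k"* L976–977); `R_nonpos`;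
* §6 **LEMMA 2.5** (`lemma25`): the printed expansion, assembled from `LocalizedActionExpansion.lemma24` and §§3–5;
* §7 a one-site instance of every hypothesis.

**Readings / located items (declared).**  (i) `R_{k,Ω,Λ}` is typed as the difference the proof uses (L1110–1112); its
closed form `R_eq` has all three `Λᶜ`-terms with the factor `−½`, in agreement with the localized display §3.13 (b2)
L5012–5018 (*"− ½Σ_{□⊂Λ_kᶜ}(a_k‖Q𝒲‖²_□ + ‖∂𝒲‖²_{*,□} + μ̄_k‖𝒲‖²_□)"*), whereas the statement display L1078–1080 prints
`−½‖𝐚^{1/2}Q_{k,Ω}𝒵‖²_{Λᶜ} + ‖∂𝒵‖²_{*,Λ} + ½μ̄_k‖𝒵‖²_{Λᶜ}` (signs of the last two terms, `Λ` for `Λᶜ`, a missing `½`) and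
(otto3)'s `R^{(1)}` L2938–2946 prints the three terms with `+½` — located sign/trace slips in two displays, immaterial
downstream where only `|R^{(1)}|` is bounded (§3.13 L5020–5030).  (ii) `Λᶜ` is the complement IN `V` (the sites of
`Ω₁`); the print's `‖∂𝒵‖²_{*,Λᶜ}` on the torus also contains the bonds from `Ω₁` to `Ω₁ᶜ` (`𝒵 = 0` outside `Ω₁`), which
here sit in `collar` (zero when every row of `D` is a lattice row); `‖𝐚^{1/2}u‖²_{Λᶜ}` is typed `Σ_{t∉Λ′} u(t)(𝐚_τu)(t)`,
the print's expression for its diagonal `𝐚`.  (iii) `𝔟_Λ(∂φ_{k,Ω}, 𝒵)` is written with `φ_{k,Ω} = φ_{k,Ω}(φ_{Ω₁ᶜ}, Ψ_{k,Ω⁺}) =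
φ⁰_{k+1,Ω⁺}` ((loopy), L1057).  (iv) The deviations of the two joined modules stand (abstract matrices and graph; the
torus, its cubes and block averages are an instance; boundary datum as a source).

**What is NOT claimed.**  The scaling remark L1084, §2.5 (random walk), §3.6–3.13's use ((otto3), the tiny-term bounds
on `R^{(1)}`), anything of B1–B16 (TEMPLATE.md §4.2 row «D2 §2.3 Lemmas 2.3, 2.5 … §2.4» maps the step to B6 §A / B9 Thms
3.1–3.3 / B10 (52) / B11 Thm 1 / B14 §3, grades T/P).  NOT summit progress; NOT a statement about any Bałaban paper; NOT
continuum; NOT Clay.  Unit `b2b-balaban-template` gen 30 (journal CLAIM D2-LEMMA25-OTTO2-KERNEL).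

**Version.**  v1.0.1 — DOCFIX fold (docstring-only; declarations, statements and proofs byte-identical to v1
p201128) of the outside cross-read b2b-balaban-beta-lit1-g28 (journal XREAD VERDICT l.2797 on request l.2739: ok CONSISTENT
5∕5, DOCFIX 1 LOW, INFO 3; certificate `HOME/b2b-balaban-beta-lit1/gen28/xread/XREAD-LocalizedSingleStep-v1.md`): D1 — the
prose of `R_eq`'s docstring located the (otto3) display of `R^{(1)}` at «L2948–2951» (which is the sentence *"The function
R^{(1)} is tiny …"*); corrected to L2936–2946, as the module docstring and the `[cite:]` tag of the same declaration already
had it.  v1 — p201128 (2026-08-19, commit 0c60cea89a5c).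
-/
noncomputable section

open Finset Matrix
open scoped Matrix
open Literature.MathematicalPhysics.QuantumFieldTheory.Dimock2011to13.StarFormIdentity
open Literature.MathematicalPhysics.QuantumFieldTheory.Dimock2011to13.LocalizedActionExpansion
open Literature.MathematicalPhysics.QuantumFieldTheory.Dimock2011to13.FluctuationCovarianceIdentity (proj)
open Literature.MathematicalPhysics.QuantumFieldTheory.Dimock2011to13.MultiRegionFreeFlow
open Literature.MathematicalPhysics.QuantumFieldTheory.Dimock2011to13.FreeFlowSingleStep

namespace Literature.MathematicalPhysics.QuantumFieldTheory.Dimock2011to13.LocalizedSingleStep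

variable {V : Type*} (G : SimpleGraph V) [DecidableRel G.Adj] [Fintype V] [DecidableEq V]
variable {ι τ σ : Type*} [Fintype ι] [Fintype τ] [Fintype σ] [DecidableEq ι] [DecidableEq τ] [DecidableEq σ]

/-! ## §1 The objects of Lemma 2.5 on the joined carrier -/

/-- **`J*_{Λ,Ω_{k+1}}(Φ_{k+1}, Φ_k, φ) = (a/2L²)‖Φ_{k+1} − QΦ_k‖²_{Ω_{k+1}} + S*_k(Λ, Φ_k, φ)`** (jstar), with the multiscale
variable `Φ_k = (Φ_{k,Ω_{k+1}}, Φ_τ) : ι ⊕ τ → ℝ` (its `Ω_{k+1}`-component first), `S*_k` = `LocalizedActionExpansion.Sstar` on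
the unit sites `Λ′ ⊆ ι ⊕ τ` of `Λ` with the kernel `Q_{k,Ω} = rows(Q_k, Q_τ)`, and `aL = a/L²`.
[cite: Dimock2013BalabanII, §2.4 (jstar) L1051–1056 (arXiv:1212.5562v2 TeX)] -/
def Jstar (w h ak μ aL : ℝ) (Λ : Finset V) (Λ' : Finset (ι ⊕ τ)) (Qk : Matrix ι V ℝ) (Qτ : Matrix τ V ℝ)
    (Q : Matrix σ ι ℝ) (Φ' : σ → ℝ) (ΦY : ι ⊕ τ → ℝ) (φ : V → ℝ) : ℝ :=
  (aL / 2) * ((Φ' - Q *ᵥ (ΦY ∘ Sum.inl)) ⬝ᵥ (Φ' - Q *ᵥ (ΦY ∘ Sum.inl)))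
    + Sstar G w h ak μ Λ Λ' (rowsO Qk Qτ) ΦY φ

/-- the level-`k` unit sites of `Λ − Ω_{k+1}` (those layer indices `t` whose variable `Φ_τ(t)` sits in `Λ′`).
[cite: Dimock2013BalabanII, §2.4 Lemma 2.5 L1067–1073 (arXiv:1212.5562v2 TeX)] -/
def layerIn (Λ' : Finset (ι ⊕ τ)) : Finset τ := Finset.univ.filter fun t => (Sum.inr t : ι ⊕ τ) ∈ Λ'

/-- the layer indices OUTSIDE `Λ′` (the unit variables of `Λᶜ`: all layers `δΩ_j`, `j < k`, and the part of `δΩ_k`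
outside `Λ`). [cite: Dimock2013BalabanII, §2.4 Lemma 2.5 L1077–1080 (arXiv:1212.5562v2 TeX)] -/
def layerOut (Λ' : Finset (ι ⊕ τ)) : Finset τ := Finset.univ.filter fun t => (Sum.inr t : ι ⊕ τ) ∉ Λ'

/-- **`S^{*,0}_{k+1}(Λ, Φ_{k+1,Ω⁺}, φ) = (a_{k+1}/2L²)‖Φ_{k+1} − Q_{k+1}φ‖²_{Ω_{k+1}} + (a_k/2)‖Φ_k − Q_kφ‖²_{Λ−Ω_{k+1}} +
½‖∂φ‖²_{*,Λ} + ½μ̄_k‖φ‖²_Λ`** with `a_{k+1}L^{−2} = aNext a_k aL` and `Q_{k+1} = QQ_k`.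
[cite: Dimock2013BalabanII, §2.4 Lemma 2.5 L1067–1074 (arXiv:1212.5562v2 TeX)] -/
def Sstar0 (w h ak μ aL : ℝ) (Λ : Finset V) (Λ' : Finset (ι ⊕ τ)) (Qk : Matrix ι V ℝ) (Qτ : Matrix τ V ℝ)
    (Q : Matrix σ ι ℝ) (Φ' : σ → ℝ) (Φτ : τ → ℝ) (φ : V → ℝ) : ℝ :=
  (aNext ak aL / 2) * ((Φ' - Q *ᵥ (Qk *ᵥ φ)) ⬝ᵥ (Φ' - Q *ᵥ (Qk *ᵥ φ)))
    + (ak / 2) * ∑ t ∈ layerIn Λ', (Φτ t - (Qτ *ᵥ φ) t) ^ 2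
    + (1 / 2) * formStar G w h Λ φ φ + (μ / 2) * ipFine w Λ φ φ

/-- **`R_{k,Ω,Λ}`** as the proof of Lemma 2.5 uses it (L1110–1112: *"(a/2L²)‖QZ‖² + S*_k(Λ, (0,Z), 𝒵_{k,Ω}) = (a/2L²)‖QZ‖²
+ S_k(Ω₁, (0,Z), 𝒵_{k,Ω}) + R_{k,Ω,Λ}"*): the localized action of the fluctuation pair MINUS the full action
`S_k(Ω₁, (0,Z), 𝒵_{k,Ω})` (`MultiRegionFreeFlow.action`), `𝒵_{k,Ω} = FreeFlowSingleStep.calZ … Z`.  Its closed form is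
`R_eq` below. [cite: Dimock2013BalabanII, §2.4 Lemma 2.5 L1075–1080 and proof L1108–1115 (arXiv:1212.5562v2 TeX)] -/
def R (w h ak μ : ℝ) (Λ : Finset V) (Λ' : Finset (ι ⊕ τ)) (D : Matrix V V ℝ) (aτ : Matrix τ τ ℝ)
    (Qk : Matrix ι V ℝ) (Qτ : Matrix τ V ℝ) (Z : ι → ℝ) : ℝ :=
  Sstar G w h ak μ Λ Λ' (rowsO Qk Qτ) (Sum.elim Z 0) (calZ D ak aτ Qk Qτ Z)
    - action D (weightO ak aτ) (rowsO Qk Qτ) (Sum.elim Z 0) (calZ D ak aτ Qk Qτ Z)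

/-- `‖𝐚^{1/2}u‖²_{Λᶜ} = Σ_{t : Φ_τ(t) ∉ Λ′} u(t)(𝐚_τu)(t)` — the layer weight form over the unit variables outside `Λ` (for
the print's diagonal `𝐚` this is `Σ_{t∉Λ′} a_t u(t)²`). [cite: Dimock2013BalabanII, §2.4 Lemma 2.5 L1077–1080
(arXiv:1212.5562v2 TeX)] -/
def normOff (Λ' : Finset (ι ⊕ τ)) (aτ : Matrix τ τ ℝ) (u : τ → ℝ) : ℝ := ∑ t ∈ layerOut Λ', u t * (aτ *ᵥ u) t

/-- the part of `⟨f, Df⟩` NOT carried by the bonds and sites of the carrier: `⟨f, Df⟩ − ‖∂f‖²_{*,V} − μ̄_k‖f‖²_V`.  For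
`D = [−Δ + μ̄_k]_{Ω₁}` with Dirichlet conditions on the sites `V` of `Ω₁` these are the bonds from `Ω₁` to `Ω₁ᶜ`
(`Σ_{x∈Ω₁, x′∉Ω₁} L^{−3k}|∂f(x,x′)|²` with `f = 0` outside) — in print a part of `‖∂𝒵‖²_{*,Λᶜ}`; zero when every row of `D`
is a lattice row. [cite: Dimock2013BalabanII, §2.2 L588–590 and §2.4 L965–970 (arXiv:1212.5562v2 TeX)] -/
def collar (w h μ : ℝ) (D : Matrix V V ℝ) (f : V → ℝ) : ℝ :=
  f ⬝ᵥ (D *ᵥ f) - formStar G w h Finset.univ f f - μ * ipFine w Finset.univ f f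

/-! ### [folklore] bookkeeping on the split `ι ⊕ τ` -/

section Split

variable {Λ' : Finset (ι ⊕ τ)}

omit [Fintype ι] in
/-- membership in `layerIn`. [folklore] -/
private theorem mem_layerIn {t : τ} : t ∈ layerIn Λ' ↔ (Sum.inr t : ι ⊕ τ) ∈ Λ' := by
  unfold layerIn
  simp only [Finset.mem_filter, Finset.mem_univ, true_and]

omit [Fintype ι] in
/-- membership in `layerOut`. [folklore] -/
private theorem mem_layerOut {t : τ} : t ∈ layerOut Λ' ↔ (Sum.inr t : ι ⊕ τ) ∉ Λ' := by
  unfold layerOut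
  simp only [Finset.mem_filter, Finset.mem_univ, true_and]

/-- a sum over `Λ′ ⊇ Ω^{(k)}_{k+1}` splits into the `Ω_{k+1}`-sites and the layer sites in `Λ′`. [folklore] -/
private theorem sum_split (hΩ : ∀ i : ι, (Sum.inl i : ι ⊕ τ) ∈ Λ') (F : ι ⊕ τ → ℝ) :
    ∑ y ∈ Λ', F y = ∑ i, F (Sum.inl i) + ∑ t ∈ layerIn Λ', F (Sum.inr t) := by
  classical
  have h1 : ∑ y ∈ Λ', F y = ∑ y, if y ∈ Λ' then F y else 0 := by
    rw [Finset.sum_ite_mem, Finset.univ_inter]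
  rw [h1, Fintype.sum_sum_type]
  congr 1
  · exact Finset.sum_congr rfl fun i _ => if_pos (hΩ i)
  · unfold layerIn
    rw [Finset.sum_filter]

omit [Fintype ι] in
/-- a sum over all layer indices splits into those in `Λ′` and those outside. [folklore] -/
private theorem sum_layer_split (F : τ → ℝ) : ∑ t, F t = ∑ t ∈ layerIn Λ', F t + ∑ t ∈ layerOut Λ', F t := by
  unfold layerIn layerOut
  exact (Finset.sum_filter_add_sum_filter_not Finset.univ (fun t => (Sum.inr t : ι ⊕ τ) ∈ Λ') F).symm

omit [DecidableEq V] [Fintype ι] [Fintype τ] [DecidableEq ι] [DecidableEq τ] in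
/-- the kernel form of `LocalizedActionExpansion` IS the matrix action of `rows(Q_k, Q_τ)`:
`Qapp (rows Q_k Q_τ) φ = (Q_kφ, Q_τφ)`. [folklore] -/
private theorem Qapp_rowsO (Qk : Matrix ι V ℝ) (Qτ : Matrix τ V ℝ) (φ : V → ℝ) :
    Qapp (rowsO Qk Qτ) φ = Sum.elim (Qk *ᵥ φ) (Qτ *ᵥ φ) := by
  unfold rowsO
  rw [← Matrix.fromRows_mulVec]
  rfl

omit [Fintype ι] [Fintype τ] [DecidableEq ι] [DecidableEq τ] in
/-- `(Φ + Z, Φ_τ) = (Φ, Φ_τ) + (Z, 0)` componentwise. [folklore] -/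
private theorem sumElim_add_inl (Φι Z : ι → ℝ) (Φτ : τ → ℝ) :
    Sum.elim (Φι + Z) Φτ = Sum.elim Φι Φτ + Sum.elim Z 0 := by
  ext (i | i)
  · rfl
  · simp

omit [Fintype ι] [Fintype τ] [DecidableEq ι] [DecidableEq τ] in
/-- componentwise subtraction of split vectors. [folklore] -/
private theorem sumElim_sub (u u' : ι → ℝ) (v v' : τ → ℝ) :
    Sum.elim u v - Sum.elim u' v' = Sum.elim (u - u') (v - v') := by
  ext (i | i) <;> rfl

end Split

/-! ## §2 The hypotheses of Lemma 2.4 for `(Ψ_{k,Ω⁺}, φ⁰_{k+1,Ω⁺})`: the variational equation on `Λ` -/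

section VarEq

variable {w h ak μ aL : ℝ} {Λ : Finset V} {Λ' : Finset (ι ⊕ τ)} {D : Matrix V V ℝ} {aτ : Matrix τ τ ℝ}
  {Qk : Matrix ι V ℝ} {Qτ : Matrix τ V ℝ} {Q : Matrix σ ι ℝ}

omit [Fintype V] [DecidableEq V] in
/-- `(Mᵀ *ᵥ v)(x) = Σ_y M(y,x) v(y)`. [folklore] -/
private theorem transpose_mulVec_apply {m : Type*} [Fintype m] (M : Matrix m V ℝ) (v : m → ℝ) (x : V) :
    (Mᵀ *ᵥ v) x = ∑ y, M y x * v y := rfl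

omit [DecidableEq τ] in
/-- the split weight `a_k ⊕ 𝐚_τ` is positive semidefinite for `a_k ≥ 0`, `𝐚_τ ≥ 0` (as in `MultiRegionFreeFlow`, where
the lemma is private). [folklore] -/
private theorem weightO_psd (hak : 0 ≤ ak) (haτ : aτ.PosSemidef) : (weightO (ι := ι) ak aτ).PosSemidef := by
  have hH : (weightO (ι := ι) ak aτ).IsHermitian := by
    unfold weightO
    refine Matrix.IsHermitian.fromBlocks ?_ (by simp) haτ.isHermitian
    rw [IsHermitian, conjTranspose_smul, star_trivial, conjTranspose_one]
  refine PosSemidef.of_dotProduct_mulVec_nonneg hH fun x => ?_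
  rw [star_trivial]
  unfold weightO
  conv_rhs => rw [← Sum.elim_comp_inl_inr x, fromBlocks_mulVec]
  simp only [Sum.elim_comp_inl, Sum.elim_comp_inr, zero_mulVec, add_zero, zero_add, sumElim_dotProduct_sumElim,
    smul_mulVec, one_mulVec, dotProduct_smul, smul_eq_mul]
  have h1 : 0 ≤ (x ∘ Sum.inl) ⬝ᵥ (x ∘ Sum.inl) := Finset.sum_nonneg fun i _ => mul_self_nonneg _
  have h2 : 0 ≤ (x ∘ Sum.inr) ⬝ᵥ (aτ *ᵥ (x ∘ Sum.inr)) := by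
    have := haτ.dotProduct_mulVec_nonneg (x ∘ Sum.inr)
    rwa [star_trivial] at this
  exact add_nonneg (mul_nonneg hak h1) h2

omit [DecidableEq V] [DecidableEq τ] in
/-- the left side of the level-`k` variational equation at a site `x`:
`([D + Q_{k,Ω}ᵀ𝐚Q_{k,Ω}]φ)(x) = (Dφ)(x) + Σ_t Q_τ(t,x)(𝐚_τQ_τφ)(t) + a_kΣ_i Q_k(i,x)(Q_kφ)(i)`. [folklore] -/
private theorem gInvO_mulVec_apply (φ : V → ℝ) (x : V) :
    (gInvO D (weightO ak aτ) (rowsO Qk Qτ) *ᵥ φ) x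
      = (D *ᵥ φ) x + ∑ t, Qτ t x * (aτ *ᵥ (Qτ *ᵥ φ)) t + ak * ∑ i, Qk i x * (Qk *ᵥ φ) i := by
  rw [gInvO_block]
  unfold restE
  rw [add_mulVec, add_mulVec, smul_mulVec, ← mulVec_mulVec, ← mulVec_mulVec, ← mulVec_mulVec]
  simp only [Pi.add_apply, Pi.smul_apply, smul_eq_mul, transpose_mulVec_apply]

omit [Fintype V] [DecidableEq V] [DecidableEq τ] in
/-- the right side at `x`: `(Q_{k,Ω}ᵀ𝐚(Ψ, Φ_τ) + src)(x) = a_kΣ_i Q_k(i,x)Ψ(i) + Σ_t Q_τ(t,x)(𝐚_τΦ_τ)(t) + src(x)`. [folklore] -/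
private theorem rhs_apply (Ψ : ι → ℝ) (Φτ : τ → ℝ) (src : V → ℝ) (x : V) :
    ((rowsO Qk Qτ)ᵀ *ᵥ (weightO ak aτ *ᵥ Sum.elim Ψ Φτ) + src) x
      = ak * ∑ i, Qk i x * Ψ i + ∑ t, Qτ t x * (aτ *ᵥ Φτ) t + src x := by
  unfold rowsO weightO
  rw [transpose_fromRows, fromBlocks_mulVec]
  simp only [Sum.elim_comp_inl, Sum.elim_comp_inr, zero_mulVec, add_zero, zero_add, smul_mulVec, one_mulVec,
    fromCols_mulVec_sumElim, Pi.add_apply, transpose_mulVec_apply, Pi.smul_apply, smul_eq_mul]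
  rw [Finset.mul_sum]
  congr 1; congr 1
  exact Finset.sum_congr rfl fun y _ => by ring

omit [Fintype V] [DecidableEq V] [Fintype ι] in
/-- under (H2) block locality and (H𝐚) `𝐚_τ = a_k` on the layer sites of `Λ′`, the layer part of the bracket collapses
on `Λ` to the scalar weight: `Σ_t Q_τ(t,x)(𝐚_τv)(t) = a_k Σ_t Q_τ(t,x)v(t)` for `x ∈ Λ`. [folklore] -/
private theorem layer_sum_eq (hQ : BlockLocal Λ Λ' (rowsO Qk Qτ))
    (ha : ∀ t, (Sum.inr t : ι ⊕ τ) ∈ Λ' → ∀ v : τ → ℝ, (aτ *ᵥ v) t = ak * v t) (v : τ → ℝ) {x : V} (hx : x ∈ Λ) :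
    ∑ t, Qτ t x * (aτ *ᵥ v) t = ak * ∑ t, Qτ t x * v t := by
  rw [Finset.mul_sum]
  refine Finset.sum_congr rfl fun t _ => ?_
  by_cases ht : (Sum.inr t : ι ⊕ τ) ∈ Λ'
  · rw [ha t ht v]
    ring
  · have h0 : Qτ t x = 0 := by
      have := hQ.2 (Sum.inr t) ht x hx
      unfold rowsO at this
      rwa [Matrix.fromRows_apply_inr] at this
    rw [h0, zero_mul, zero_mul, mul_zero]

/-- **(H1) FOR LEMMA 2.5.**  With `φ⁰ = φ⁰_{k+1,Ω⁺}` (`FreeFlowSingleStep.phi0`) and `Ψ = Ψ_{k,Ω_{k+1}}(Ω⁺) = Ψ_k(Φ_{k+1}, φ⁰)`: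
by (loopy) `φ⁰ = φ_{k,Ω}(φ_{Ω₁ᶜ}, Ψ_{k,Ω⁺})`, so `φ⁰` solves the level-`k` variational equation of Theorem 2.1 with data
`(Ψ, Φ_τ)`; read at the sites of `Λ` under (α) lattice rows of `D` on `Λ`, (γ) no boundary source on `Λ`, (H2) block
locality and (H𝐚) `𝐚 = a_k` on the level-`k` layer inside `Λ`, this is `LocalizedActionExpansion.VarEqOn` for
`(Φ_k, φ) = ((Ψ, Φ_τ), φ⁰)` — the hypothesis (H1) of Lemma 2.4 *"by the definition (unknown) of φ_{k,Ω}"*.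
[cite: Dimock2013BalabanII, Lemma 2.3 (loopy) L762–774; §2.4 L995–997, L1043; Lemma 2.5 proof L1087 (arXiv:1212.5562v2 TeX)] -/
theorem varEqOn_phi0 (hD : D.PosDef) (haτ : aτ.PosSemidef) (hak : 0 < ak) (haL : 0 ≤ aL)
    (hDΛ : ∀ f : V → ℝ, ∀ x ∈ Λ, (D *ᵥ f) x = w * negLap G h f x + w * (μ * f x))
    (hQ : BlockLocal Λ Λ' (rowsO Qk Qτ))
    (ha : ∀ t, (Sum.inr t : ι ⊕ τ) ∈ Λ' → ∀ v : τ → ℝ, (aτ *ᵥ v) t = ak * v t)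
    (Φ' : σ → ℝ) (Φτ : τ → ℝ) {src : V → ℝ} (hsrc : ∀ x ∈ Λ, src x = 0) :
    VarEqOn G w h ak μ Λ (rowsO Qk Qτ)
      (Sum.elim (Psi Qk Q ak aL Φ' (phi0 D ak aτ Qk Qτ Q aL Φ' Φτ src)) Φτ)
      (phi0 D ak aτ Qk Qτ Q aL Φ' Φτ src) := by
  set φ₀ := phi0 D ak aτ Qk Qτ Q aL Φ' Φτ src with hφ₀
  set Ψ := Psi Qk Q ak aL Φ' φ₀ with hΨ
  -- (loopy): φ⁰ is the level-k minimizer at the data (Ψ, Φ_τ), hence solves the variational equation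
  have hsol : gInvO D (weightO ak aτ) (rowsO Qk Qτ) *ᵥ φ₀
      = (rowsO Qk Qτ)ᵀ *ᵥ (weightO ak aτ *ᵥ Sum.elim Ψ Φτ) + src := by
    have h := variational_eq (Qm := rowsO Qk Qτ) hD (weightO_psd (ι := ι) hak.le haτ) (Sum.elim Ψ Φτ) src
    rwa [minimizer_Psi_phi0 hD haτ hak haL Φ' Φτ src] at h
  intro x hx
  have h1 := congrFun hsol x
  rw [gInvO_mulVec_apply, rhs_apply, hDΛ _ x hx, hsrc x hx, layer_sum_eq hQ ha _ hx, layer_sum_eq hQ ha _ hx] at h1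
  -- the sum over all unit variables y : ι ⊕ τ
  rw [Qapp_rowsO, Fintype.sum_sum_type]
  unfold rowsO
  simp only [Matrix.fromRows_apply_inl, Matrix.fromRows_apply_inr, Sum.elim_inl, Sum.elim_inr]
  have hsplit1 : ∑ i, Qk i x * ((Qk *ᵥ φ₀) i - Ψ i) = ∑ i, Qk i x * (Qk *ᵥ φ₀) i - ∑ i, Qk i x * Ψ i := by
    rw [← Finset.sum_sub_distrib]
    exact Finset.sum_congr rfl fun i _ => by ring
  have hsplit2 : ∑ t, Qτ t x * ((Qτ *ᵥ φ₀) t - Φτ t) = ∑ t, Qτ t x * (Qτ *ᵥ φ₀) t - ∑ t, Qτ t x * Φτ t := by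
    rw [← Finset.sum_sub_distrib]
    exact Finset.sum_congr rfl fun t _ => by ring
  rw [mul_add, hsplit1, hsplit2]
  linarith

end VarEq

/-! ## §3 The linear terms vanish (L1096–1101) -/

section Linear

variable {ak aL : ℝ} {Λ' : Finset (ι ⊕ τ)} {Qk : Matrix ι V ℝ} {Qτ : Matrix τ V ℝ} {Q : Matrix σ ι ℝ}

omit [DecidableEq ι] [DecidableEq σ] in
/-- `⟨QZ, w⟩ = ⟨Z, Qᵀw⟩`. [folklore] -/
private theorem Q_mulVec_dot (Q : Matrix σ ι ℝ) (Z : ι → ℝ) (v : σ → ℝ) : (Q *ᵥ Z) ⬝ᵥ v = Z ⬝ᵥ (Qᵀ *ᵥ v) := by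
  rw [dotProduct_mulVec, vecMul_transpose]

omit [DecidableEq ι] [DecidableEq σ] in
/-- `⟨Z, QᵀQ Z′⟩ = ⟨QZ, QZ′⟩`. [folklore] -/
private theorem dot_proj_mulVec (Q : Matrix σ ι ℝ) (Z Z' : ι → ℝ) :
    Z ⬝ᵥ (proj Q *ᵥ Z') = (Q *ᵥ Z) ⬝ᵥ (Q *ᵥ Z') := by
  unfold proj
  rw [← mulVec_mulVec, dotProduct_mulVec, vecMul_transpose]

omit [DecidableEq V] in
/-- (cherry0) rearranged: `a_k(Ψ_k − Q_kφ) = aL·Qᵀ(Φ_{k+1} − QΨ_k)` — *"(a/L²)Qᵀ(Φ_{k+1} − QΨ_{k,Ω_{k+1}}(Ω⁺)) = … = a_k(Ψ_{k,Ω_{k+1}}(Ω⁺)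
− Q_kφ⁰_{k+1,Ω⁺}) as one can check by inserting the definition of Ψ_{k,Ω_{k+1}}(Ω⁺) from (eddie2)"*.
[cite: Dimock2013BalabanII, §2.4 Lemma 2.5 proof L1096–1101 (arXiv:1212.5562v2 TeX)] -/
theorem ak_smul_Psi_sub (hQ : Q * Qᵀ = 1) (hne : ak + aL ≠ 0) (Φ' : σ → ℝ) (φ : V → ℝ) :
    ak • (Psi Qk Q ak aL Φ' φ - Qk *ᵥ φ) = aL • (Qᵀ *ᵥ (Φ' - Q *ᵥ Psi Qk Q ak aL Φ' φ)) := by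
  have h := oneStepH_mulVec_Psi (Qk := Qk) hQ hne Φ' φ
  unfold oneStepH at h
  rw [add_mulVec, smul_mulVec, one_mulVec, smul_mulVec] at h
  unfold proj at h
  rw [← mulVec_mulVec] at h
  rw [smul_sub, mulVec_sub, smul_sub]
  -- h : ak • Ψ + aL • Qᵀ(QΨ) = ak • Q_kφ + aL • QᵀΦ′
  linear_combination (exp := 1) h

omit [DecidableEq V] in
/-- **THE LINEAR TERMS VANISH** — *"However the linear terms vanish since (a/L²)Qᵀ(Φ_{k+1} − QΨ) = a_k(Ψ − Q_kφ⁰)"*: the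
cross term of `(a/2L²)‖Φ_{k+1} − Q(Ψ + Z)‖²` cancels the linear term `a_k⟨Z, Φ_k − Q_kφ⟩_Λ` of Lemma 2.4 (with
`Ω^{(k)}_{k+1} ⊆ Λ′`, the unit-lattice pairing of `(Z, 0)` sees only the `Ω_{k+1}`-component).
[cite: Dimock2013BalabanII, §2.4 Lemma 2.5 proof L1089–1101 (arXiv:1212.5562v2 TeX)] -/
theorem linear_terms (hQ : Q * Qᵀ = 1) (hne : ak + aL ≠ 0) (hΩ : ∀ i : ι, (Sum.inl i : ι ⊕ τ) ∈ Λ')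
    (Φ' : σ → ℝ) (Φτ : τ → ℝ) (φ : V → ℝ) (Z : ι → ℝ) :
    -(aL * ((Q *ᵥ Z) ⬝ᵥ (Φ' - Q *ᵥ Psi Qk Q ak aL Φ' φ)))
      + ak * ipUnit Λ' (Sum.elim Z 0) (Sum.elim (Psi Qk Q ak aL Φ' φ) Φτ - Qapp (rowsO Qk Qτ) φ) = 0 := by
  set Ψ := Psi Qk Q ak aL Φ' φ with hΨ
  have hip : ipUnit Λ' (Sum.elim Z 0) (Sum.elim Ψ Φτ - Qapp (rowsO Qk Qτ) φ) = Z ⬝ᵥ (Ψ - Qk *ᵥ φ) := by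
    unfold ipUnit
    rw [Qapp_rowsO, sumElim_sub, sum_split hΩ]
    simp only [Sum.elim_inl, Sum.elim_inr, Pi.zero_apply, zero_mul, Finset.sum_const_zero, add_zero]
    rfl
  have hv := congrArg (fun v => Z ⬝ᵥ v) (ak_smul_Psi_sub (Qk := Qk) hQ hne Φ' φ)
  simp only [dotProduct_smul, smul_eq_mul] at hv
  rw [← hΨ] at hv
  rw [hip, Q_mulVec_dot]
  linear_combination hv

end Linear

/-! ## §4 The terms at `Z = 0`: `(a/2L²)‖Φ_{k+1} − QΨ‖² + S*_k(Λ, Ψ_{k,Ω⁺}, φ⁰) = S^{*,0}_{k+1}(Λ, Φ_{k+1,Ω⁺}, φ⁰)` (stung)/(stung2) -/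

section Constant

variable {w h ak μ aL : ℝ} {Λ : Finset V} {Λ' : Finset (ι ⊕ τ)} {Qk : Matrix ι V ℝ} {Qτ : Matrix τ V ℝ}
  {Q : Matrix σ ι ℝ}

/-- **(stung)/(stung2) FOR THE LOCALIZED ACTION** — *"Also as in (stung), (stung2) (a/2L²)‖Φ_{k+1} − QΨ_{k,Ω_{k+1}}(Ω⁺)‖²
+ S*_k(Λ, Ψ_{k,Ω_{k+1}}(Ω⁺), φ⁰_{k+1,Ω⁺}) = S^{*,0}_{k+1}(Λ, Φ_{k+1,Ω⁺}, φ⁰_{k+1,Ω⁺})"*: the `Ω_{k+1}`-part of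
`(a_k/2)‖Φ_k − Q_kφ‖²_Λ` combines with `(a/2L²)‖Φ_{k+1} − QΨ‖²` into `(a_{k+1}/2L²)‖Φ_{k+1} − Q_{k+1}φ‖²` by (stringy2)
(`FreeFlowSingleStep.stringy_Psi`); holds for every `φ`. [cite: Dimock2013BalabanII, §2.4 Lemma 2.5 proof L1102–1106
(arXiv:1212.5562v2 TeX)] -/
theorem constant_terms (hQ : Q * Qᵀ = 1) (hne : ak + aL ≠ 0) (hΩ : ∀ i : ι, (Sum.inl i : ι ⊕ τ) ∈ Λ')
    (Φ' : σ → ℝ) (Φτ : τ → ℝ) (φ : V → ℝ) :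
    (aL / 2) * ((Φ' - Q *ᵥ Psi Qk Q ak aL Φ' φ) ⬝ᵥ (Φ' - Q *ᵥ Psi Qk Q ak aL Φ' φ))
        + Sstar G w h ak μ Λ Λ' (rowsO Qk Qτ) (Sum.elim (Psi Qk Q ak aL Φ' φ) Φτ) φ
      = Sstar0 G w h ak μ aL Λ Λ' Qk Qτ Q Φ' Φτ φ := by
  set Ψ := Psi Qk Q ak aL Φ' φ with hΨ
  have hip : ipUnit Λ' (Sum.elim Ψ Φτ - Qapp (rowsO Qk Qτ) φ) (Sum.elim Ψ Φτ - Qapp (rowsO Qk Qτ) φ)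
      = (Ψ - Qk *ᵥ φ) ⬝ᵥ (Ψ - Qk *ᵥ φ) + ∑ t ∈ layerIn Λ', (Φτ t - (Qτ *ᵥ φ) t) ^ 2 := by
    unfold ipUnit
    rw [Qapp_rowsO, sumElim_sub, sum_split hΩ]
    simp only [Sum.elim_inl, Sum.elim_inr, Pi.sub_apply, pow_two]
    rfl
  have hs := stringy_Psi (Qk := Qk) hQ hne Φ' φ
  unfold stringy at hs
  rw [← hΨ] at hs
  unfold Sstar Sstar0
  rw [hip]
  linarith

end Constant

/-! ## §5 The quadratic terms and `R_{k,Ω,Λ}` (L1108–1115), with its closed form -/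

section Quadratic

variable {w h ak μ aL : ℝ} {Λ : Finset V} {Λ' : Finset (ι ⊕ τ)} {D : Matrix V V ℝ} {aτ : Matrix τ τ ℝ}
  {Qk : Matrix ι V ℝ} {Qτ : Matrix τ V ℝ} {Q : Matrix σ ι ℝ}

omit [DecidableEq τ] [DecidableEq σ] in
/-- **THE QUADRATIC TERMS** — *"Finally (a/2L²)‖QZ‖² + S*_k(Λ, (0,Z), 𝒵_{k,Ω}) = (a/2L²)‖QZ‖² + S_k(Ω₁, (0,Z), 𝒵_{k,Ω}) +
R_{k,Ω,Λ} = ½⟨Z, [Δ_{k,Ω} + (a/L²)QᵀQ]_{Ω_{k+1}} Z⟩ + R_{k,Ω,Λ}. The last step is from (worry)"* (`FreeFlowSingleStep.quadratic_terms`;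
`D > 0`, `𝐚_τ ≥ 0`, `a_k ≥ 0`). [cite: Dimock2013BalabanII, §2.4 Lemma 2.5 proof L1108–1115 (arXiv:1212.5562v2 TeX)] -/
theorem quadratic_terms_R (hD : D.PosDef) (haτ : aτ.PosSemidef) (hak : 0 ≤ ak) (Z : ι → ℝ) :
    (aL / 2) * ((Q *ᵥ Z) ⬝ᵥ (Q *ᵥ Z))
        + Sstar G w h ak μ Λ Λ' (rowsO Qk Qτ) (Sum.elim Z 0) (calZ D ak aτ Qk Qτ Z)
      = (1 / 2) * (Z ⬝ᵥ (((DeltakO D (weightO ak aτ) (rowsO Qk Qτ)).toBlocks₁₁ + aL • proj Q) *ᵥ Z))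
        + R G w h ak μ Λ Λ' D aτ Qk Qτ Z := by
  have hq := FreeFlowSingleStep.quadratic_terms (Qk := Qk) (Qτ := Qτ) (Q := Q) (aL := aL) hD haτ hak Z
  unfold FreeFlowSingleStep.J energy at hq
  rw [zero_sub, neg_dotProduct, dotProduct_neg, neg_neg, dotProduct_zero, sub_zero] at hq
  rw [add_mulVec, dotProduct_add, smul_mulVec, dotProduct_smul, dot_proj_mulVec, smul_eq_mul]
  unfold R
  linarith

omit [DecidableEq V] [DecidableEq τ] in
/-- the full action of the fluctuation pair splits along `ι ⊕ τ` and the sites: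
`S_k(Ω₁, (0,Z), 𝒵) = (a_k/2)‖Z − Q_k𝒵‖² + ½⟨Q_τ𝒵, 𝐚_τQ_τ𝒵⟩ + ½⟨𝒵, D𝒵⟩`. [folklore] -/
private theorem action_sumElim_zero (Z : ι → ℝ) (f : V → ℝ) :
    action D (weightO ak aτ) (rowsO Qk Qτ) (Sum.elim Z 0) f
      = (ak / 2) * ((Z - Qk *ᵥ f) ⬝ᵥ (Z - Qk *ᵥ f)) + (1 / 2) * ((Qτ *ᵥ f) ⬝ᵥ (aτ *ᵥ (Qτ *ᵥ f)))
        + (1 / 2) * (f ⬝ᵥ (D *ᵥ f)) := by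
  rw [action_block]
  unfold action
  rw [zero_sub, neg_dotProduct, mulVec_neg, dotProduct_neg, neg_neg]
  ring

/-- the site form over `Λ` plus over `Λᶜ` is the site form over everything. [folklore] -/
private theorem ipFine_add_compl (f : V → ℝ) : ipFine w Λ f f + ipFine w Λᶜ f f = ipFine w Finset.univ f f := by
  unfold ipFine
  rw [← Finset.sum_union (disjoint_compl_right (a := Λ)), Finset.union_compl]

/-- the star form over `Λ` plus over `Λᶜ` is the star form over everything (the additivity L971–975 of
`StarFormIdentity.formStar_union`). [cite: Dimock2013BalabanII, §2.4 L971–977 (arXiv:1212.5562v2 TeX)] -/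
private theorem formStar_add_compl (f : V → ℝ) :
    formStar G w h Λ f f + formStar G w h Λᶜ f f = formStar G w h Finset.univ f f := by
  rw [← formStar_union G w h (disjoint_compl_right (a := Λ)), Finset.union_compl]

/-- **`R_{k,Ω,Λ}` IN CLOSED FORM**: with `Ω^{(k)}_{k+1} ⊆ Λ′` and `𝐚 = a_k` on the layer sites of `Λ′`,
`R_{k,Ω,Λ} = −[½‖𝐚^{1/2}Q_{k,Ω}𝒵‖²_{Λᶜ} + ½‖∂𝒵‖²_{*,Λᶜ} + ½μ̄_k‖𝒵‖²_{Λᶜ}] − ½·collar(𝒵)` (`𝒵 = 𝒵_{k,Ω}`): the localized action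
drops exactly the non-negative `Λᶜ`-contributions of `S_k(Ω₁, (0,Z), 𝒵)` — by the additivity of `S*` over `Λ ∪ Λᶜ`
(*"A similar decomposition holds for S*_k(Λ, Φ_{k,Ω}, φ)"*, L976–977).  The print displays (L1078–1080) `R_{k,Ω,Λ} ≡
−½‖𝐚^{1/2}Q_{k,Ω}𝒵_{k,Ω}‖²_{Λᶜ} + ‖∂𝒵_{k,Ω}‖²_{*,Λ} + ½μ̄_k‖𝒵_{k,Ω}‖²_{Λᶜ}` and, at the use site §3.6 (otto3) L2936–2946,
`R^{(1)} = 𝔟_{Λ_k}[∂φ⁰, 𝒵] + ½‖𝐚^{1/2}Q_{k,Ω}𝒵‖²_{Λ_kᶜ} + ½‖∂𝒵‖²_{*,Λ_kᶜ} + ½μ̄_k‖𝒵‖²_{Λ_kᶜ}`; the kernel identity fixes the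
signs (all three `Λᶜ`-terms enter with `−½`; `R_nonpos`), in agreement with the localized display §3.13 (b2) L5012–5018
(*"− ½Σ_{□⊂Λ_kᶜ}(a_k‖Q𝒲‖²_□ + ‖∂𝒲‖²_{*,□} + μ̄_k‖𝒲‖²_□)"*) — immaterial downstream, where only `|R^{(1)}|` is bounded
(§3.13). [cite: Dimock2013BalabanII, §2.4 Lemma 2.5 L1077–1080, proof L1108–1116; §3.6 (otto3) L2936–2946; §3.13 (b2)
L5012–5018 (arXiv:1212.5562v2 TeX)] -/
theorem R_eq (hΩ : ∀ i : ι, (Sum.inl i : ι ⊕ τ) ∈ Λ')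
    (ha : ∀ t, (Sum.inr t : ι ⊕ τ) ∈ Λ' → ∀ v : τ → ℝ, (aτ *ᵥ v) t = ak * v t) (Z : ι → ℝ) :
    R G w h ak μ Λ Λ' D aτ Qk Qτ Z
      = -((1 / 2) * normOff Λ' aτ (Qτ *ᵥ calZ D ak aτ Qk Qτ Z)
          + (1 / 2) * formStar G w h Λᶜ (calZ D ak aτ Qk Qτ Z) (calZ D ak aτ Qk Qτ Z)
          + (μ / 2) * ipFine w Λᶜ (calZ D ak aτ Qk Qτ Z) (calZ D ak aτ Qk Qτ Z))
        - (1 / 2) * collar G w h μ D (calZ D ak aτ Qk Qτ Z) := by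
  set f := calZ D ak aτ Qk Qτ Z with hf
  -- the unit-lattice part of S* over Λ′: the Ω_{k+1}-sites and the layer sites in Λ′ (weight a_k there)
  have hip : ipUnit Λ' (Sum.elim Z 0 - Qapp (rowsO Qk Qτ) f) (Sum.elim Z 0 - Qapp (rowsO Qk Qτ) f)
      = (Z - Qk *ᵥ f) ⬝ᵥ (Z - Qk *ᵥ f) + ∑ t ∈ layerIn Λ', (Qτ *ᵥ f) t * (Qτ *ᵥ f) t := by
    unfold ipUnit dotProduct
    rw [Qapp_rowsO, sumElim_sub, sum_split hΩ]
    simp only [Sum.elim_inl, Sum.elim_inr, Pi.sub_apply, zero_sub, Pi.neg_apply, neg_mul_neg]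
  -- the layer weight form splits: ⟨u, 𝐚_τu⟩ = a_k Σ_{t∈Λ′} u(t)² + ‖𝐚^{1/2}u‖²_{Λᶜ}
  have hlayer : (Qτ *ᵥ f) ⬝ᵥ (aτ *ᵥ (Qτ *ᵥ f))
      = ak * ∑ t ∈ layerIn Λ', (Qτ *ᵥ f) t * (Qτ *ᵥ f) t + normOff Λ' aτ (Qτ *ᵥ f) := by
    unfold dotProduct normOff
    rw [sum_layer_split (Λ' := Λ'), Finset.mul_sum]
    congr 1
    refine Finset.sum_congr rfl fun t ht => ?_
    rw [ha t (mem_layerIn.1 ht)]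
    ring
  have hcol : f ⬝ᵥ (D *ᵥ f) = formStar G w h Finset.univ f f + μ * ipFine w Finset.univ f f + collar G w h μ D f := by
    unfold collar
    ring
  unfold R Sstar
  rw [hip, action_sumElim_zero, hlayer, hcol, ← formStar_add_compl G (Λ := Λ) f, ← ipFine_add_compl (Λ := Λ) f]
  ring

/-- … hence **`R_{k,Ω,Λ} ≤ 0`** whenever the dropped forms are non-negative (`w ≥ 0`, `μ̄_k ≥ 0`, `‖𝐚^{1/2}·‖²_{Λᶜ} ≥ 0` —
automatic for the print's diagonal `𝐚 ≥ 0` — and a non-negative collar, e.g. Dirichlet rows).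
[cite: Dimock2013BalabanII, §2.4 Lemma 2.5 L1075–1080 (arXiv:1212.5562v2 TeX)] -/
theorem R_nonpos (hΩ : ∀ i : ι, (Sum.inl i : ι ⊕ τ) ∈ Λ')
    (ha : ∀ t, (Sum.inr t : ι ⊕ τ) ∈ Λ' → ∀ v : τ → ℝ, (aτ *ᵥ v) t = ak * v t) (hw : 0 ≤ w) (hμ : 0 ≤ μ)
    (haτ : ∀ u : τ → ℝ, 0 ≤ normOff Λ' aτ u) (hcol : ∀ f : V → ℝ, 0 ≤ collar G w h μ D f) (Z : ι → ℝ) :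
    R G w h ak μ Λ Λ' D aτ Qk Qτ Z ≤ 0 := by
  rw [R_eq G hΩ ha Z]
  set f := calZ D ak aτ Qk Qτ Z
  have h1 : 0 ≤ formStar G w h Λᶜ f f := by
    rw [formStar_eq_half_sum]
    refine mul_nonneg (by norm_num) (Finset.sum_nonneg fun x _ => Finset.sum_nonneg fun x' _ => ?_)
    have : 0 ≤ sgrad h f x x' * sgrad h f x x' := mul_self_nonneg _
    nlinarith
  have h2 : 0 ≤ ipFine w Λᶜ f f := by
    unfold ipFine
    exact Finset.sum_nonneg fun x _ => mul_nonneg hw (mul_self_nonneg _)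
  nlinarith [haτ (Qτ *ᵥ f), hcol f, mul_nonneg hμ h2]

end Quadratic

/-! ## §6 LEMMA 2.5 (otto2) -/

section Otto2

variable {w h ak μ aL : ℝ} {Λ : Finset V} {Λ' : Finset (ι ⊕ τ)} {D : Matrix V V ℝ} {aτ : Matrix τ τ ℝ}
  {Qk : Matrix ι V ℝ} {Qτ : Matrix τ V ℝ} {Q : Matrix σ ι ℝ}

omit [DecidableEq σ] in
/-- `‖a − b‖² = ‖a‖² − 2⟨b, a⟩ + ‖b‖²`. [folklore] -/
private theorem dot_sub_self (a b : σ → ℝ) : (a - b) ⬝ᵥ (a - b) = a ⬝ᵥ a - 2 * (b ⬝ᵥ a) + b ⬝ᵥ b := by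
  rw [sub_dotProduct, dotProduct_sub, dotProduct_sub, dotProduct_comm a b]
  ring

/-- **LEMMA 2.5** ([Dimock2013BalabanII] §2.4, (otto2)): in the geometry (geometry) — `D = [−Δ + μ̄_k]_{Ω₁} > 0` with lattice
rows on `Λ` (α) and no boundary source on `Λ` (γ, *"separation"*), `Q_{k,Ω} = rows(Q_k, Q_τ)` block-local for `Λ` (H2),
`Ω^{(k)}_{k+1} ⊆ Λ′` (`Λ ⊃ Ω_{k+1}`), `𝐚 = a_k` on the level-`k` layer sites inside `Λ` (H𝐚), `𝐚_τ ≥ 0`, `a_k > 0`, `aL = a/L²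
≥ 0`, `QQᵀ = I` — for every `Z : Ω^{(k)}_{k+1} → ℝ`, with `Ψ = Ψ_{k,Ω_{k+1}}(Ω⁺)`, `φ⁰ = φ⁰_{k+1,Ω⁺}`, `𝒵_{k,Ω} = φ_{k,Ω}(0,Z)`:
`J*_{Λ,Ω_{k+1}}(Φ_{k+1}, Ψ_{k,Ω⁺} + (0,Z), φ⁰ + 𝒵_{k,Ω}) = S^{*,0}_{k+1}(Λ, Φ_{k+1,Ω⁺}, φ⁰) + ½⟨Z, [Δ_{k,Ω} + (a/L²)QᵀQ]_{Ω_{k+1}}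
Z⟩ + R_{k,Ω,Λ} + 𝔟_Λ(∂φ_{k,Ω}, 𝒵_{k,Ω})` where `φ_{k,Ω} = φ_{k,Ω}(φ_{Ω₁ᶜ}, Ψ_{k,Ω⁺}) = φ⁰` by (loopy).  Proof as printed:
Lemma 2.4 (`LocalizedActionExpansion.lemma24`, its (H1) being `varEqOn_phi0`), the linear terms vanish (`linear_terms`),
(stung)/(stung2) (`constant_terms`), (worry) (`quadratic_terms_R`). [cite: Dimock2013BalabanII, §2.4 Lemma 2.5 (otto2)
L1060–1081, proof L1087–1116 (arXiv:1212.5562v2 TeX)] -/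
theorem lemma25 (hD : D.PosDef) (haτ : aτ.PosSemidef) (hQQ : Q * Qᵀ = 1) (hak : 0 < ak) (haL : 0 ≤ aL)
    (hDΛ : ∀ f : V → ℝ, ∀ x ∈ Λ, (D *ᵥ f) x = w * negLap G h f x + w * (μ * f x))
    (hQ : BlockLocal Λ Λ' (rowsO Qk Qτ)) (hΩ : ∀ i : ι, (Sum.inl i : ι ⊕ τ) ∈ Λ')
    (ha : ∀ t, (Sum.inr t : ι ⊕ τ) ∈ Λ' → ∀ v : τ → ℝ, (aτ *ᵥ v) t = ak * v t)
    (Φ' : σ → ℝ) (Φτ : τ → ℝ) {src : V → ℝ} (hsrc : ∀ x ∈ Λ, src x = 0) (Z : ι → ℝ) :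
    Jstar G w h ak μ aL Λ Λ' Qk Qτ Q Φ'
        (Sum.elim (Psi Qk Q ak aL Φ' (phi0 D ak aτ Qk Qτ Q aL Φ' Φτ src) + Z) Φτ)
        (phi0 D ak aτ Qk Qτ Q aL Φ' Φτ src + calZ D ak aτ Qk Qτ Z)
      = Sstar0 G w h ak μ aL Λ Λ' Qk Qτ Q Φ' Φτ (phi0 D ak aτ Qk Qτ Q aL Φ' Φτ src)
        + (1 / 2) * (Z ⬝ᵥ (((DeltakO D (weightO ak aτ) (rowsO Qk Qτ)).toBlocks₁₁ + aL • proj Q) *ᵥ Z))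
        + R G w h ak μ Λ Λ' D aτ Qk Qτ Z
        + bdry G w h Λ (phi0 D ak aτ Qk Qτ Q aL Φ' Φτ src) (calZ D ak aτ Qk Qτ Z) := by
  have hne : ak + aL ≠ 0 := by linarith
  set φ₀ := phi0 D ak aτ Qk Qτ Q aL Φ' Φτ src with hφ₀
  set Ψ := Psi Qk Q ak aL Φ' φ₀ with hΨ
  set f := calZ D ak aτ Qk Qτ Z with hf
  -- Lemma 2.4 at (Φ_k, φ) = ((Ψ, Φ_τ), φ⁰) with (Z, 𝒵) = ((Z, 0), 𝒵_{k,Ω})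
  have hvar : VarEqOn G w h ak μ Λ (rowsO Qk Qτ) (Sum.elim Ψ Φτ) φ₀ := by
    rw [hΨ, hφ₀]
    exact varEqOn_phi0 G hD haτ hak haL hDΛ hQ ha Φ' Φτ hsrc
  have h24 := lemma24 G hvar hQ (Sum.elim Z 0) f
  -- the pieces
  have hlin := linear_terms (Qk := Qk) (Qτ := Qτ) hQQ hne hΩ Φ' Φτ φ₀ Z
  have hconst := constant_terms G (w := w) (h := h) (μ := μ) (Λ := Λ) (Qk := Qk) (Qτ := Qτ) hQQ hne hΩ Φ' Φτ φ₀
  have hquad := quadratic_terms_R G (w := w) (h := h) (μ := μ) (Λ := Λ) (Λ' := Λ') (Qk := Qk) (Qτ := Qτ) (Q := Q)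
    (aL := aL) hD haτ hak.le Z
  rw [← hΨ] at hlin hconst
  rw [← hf] at hquad
  -- expand J*
  unfold Jstar
  rw [Sum.elim_comp_inl, sumElim_add_inl, h24, mulVec_add, ← sub_sub, dot_sub_self]
  linear_combination hconst + hquad + hlin

end Otto2

/-! ## §7 Non-vacuity: one site per lattice -/

/-- Every hypothesis of `lemma25` is met on one fine site, one `Ω_{k+1}`-site, one layer site and one next-level site:
`V = ι = τ = σ = Unit`, the empty graph, `D = 1` (so (α) reads `(1·f)(x) = 0 + f(x)` with `w = μ̄ = 1`), `𝐚_τ = Q_k = Q = 1`,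
`Q_τ = 0` (the layer does not meet `Λ`), `Λ = {()}`, `Λ′ = {inl ()}`, `a_k = aL = 1`, no source. -/
example (Φ' Φτ : Unit → ℝ) (Z : Unit → ℝ) :
    Jstar (⊥ : SimpleGraph Unit) 1 1 1 1 1 Finset.univ ({Sum.inl ()} : Finset (Unit ⊕ Unit))
        (1 : Matrix Unit Unit ℝ) (0 : Matrix Unit Unit ℝ) (1 : Matrix Unit Unit ℝ) Φ'
        (Sum.elim (Psi (1 : Matrix Unit Unit ℝ) (1 : Matrix Unit Unit ℝ) 1 1 Φ'
          (phi0 (1 : Matrix Unit Unit ℝ) 1 (1 : Matrix Unit Unit ℝ) (1 : Matrix Unit Unit ℝ) 0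
            (1 : Matrix Unit Unit ℝ) 1 Φ' Φτ 0) + Z) Φτ)
        (phi0 (1 : Matrix Unit Unit ℝ) 1 (1 : Matrix Unit Unit ℝ) (1 : Matrix Unit Unit ℝ) 0
            (1 : Matrix Unit Unit ℝ) 1 Φ' Φτ 0 + calZ (1 : Matrix Unit Unit ℝ) 1 (1 : Matrix Unit Unit ℝ) 1 0 Z)
      = Sstar0 (⊥ : SimpleGraph Unit) 1 1 1 1 1 Finset.univ ({Sum.inl ()} : Finset (Unit ⊕ Unit))
          (1 : Matrix Unit Unit ℝ) 0 (1 : Matrix Unit Unit ℝ) Φ' Φτ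
          (phi0 (1 : Matrix Unit Unit ℝ) 1 (1 : Matrix Unit Unit ℝ) (1 : Matrix Unit Unit ℝ) 0
            (1 : Matrix Unit Unit ℝ) 1 Φ' Φτ 0)
        + (1 / 2) * (Z ⬝ᵥ (((DeltakO (1 : Matrix Unit Unit ℝ) (weightO 1 (1 : Matrix Unit Unit ℝ))
            (rowsO (1 : Matrix Unit Unit ℝ) 0)).toBlocks₁₁ + (1 : ℝ) • proj (1 : Matrix Unit Unit ℝ)) *ᵥ Z))
        + R (⊥ : SimpleGraph Unit) 1 1 1 1 Finset.univ ({Sum.inl ()} : Finset (Unit ⊕ Unit))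
            (1 : Matrix Unit Unit ℝ) (1 : Matrix Unit Unit ℝ) (1 : Matrix Unit Unit ℝ) 0 Z
        + bdry (⊥ : SimpleGraph Unit) 1 1 Finset.univ
            (phi0 (1 : Matrix Unit Unit ℝ) 1 (1 : Matrix Unit Unit ℝ) (1 : Matrix Unit Unit ℝ) 0
              (1 : Matrix Unit Unit ℝ) 1 Φ' Φτ 0)
            (calZ (1 : Matrix Unit Unit ℝ) 1 (1 : Matrix Unit Unit ℝ) 1 0 Z) := by
  refine lemma25 (⊥ : SimpleGraph Unit) Matrix.PosDef.one Matrix.PosSemidef.one (by simp) one_pos zero_le_one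
    (fun f x _ => by simp [negLap]) ?_ (fun _ => Finset.mem_singleton_self _) ?_ Φ' Φτ (fun _ _ => rfl) Z
  · refine ⟨fun y _ x hx => absurd (Finset.mem_univ x) hx, fun y hy x _ => ?_⟩
    rcases y with ⟨⟨⟩⟩ | ⟨⟨⟩⟩
    · exact absurd (Finset.mem_singleton_self _) hy
    · rfl
  · intro t ht
    exact absurd (Finset.mem_singleton.1 ht) (by simp)

end Literature.MathematicalPhysics.QuantumFieldTheory.Dimock2011to13.LocalizedSingleStep
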